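import Literature.MathematicalPhysics.QuantumFieldTheory.Balaban1983to89.B9Eq326DeltaABlockDecayTowerTwoBackgroundsClosed
import Literature.MathematicalPhysics.QuantumFieldTheory.Balaban1983to89.B9Eq349ConjugatedProjectionDifferenceTowerTwoBackgrounds

/-!
# `Balaban1983to89.B9Eq326DeltaABlockDecayTowerTwoBackgroundsDeltaR` — T. Bałaban, *Propagators for lattice gauge theories in a background field*, Commun.
# Math. Phys. **99** (1985) 389–434 [Balaban1985BackgroundPropagators] (3.26) p. 395, (3.15)–(3.19) p. 393, (3.21)∕(3.25) p. 394, (3.49) p. 399, (3.69) p. 404,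
# Thm 3.11 p. 416, with [Balaban1985Variational] (110) p. 294: **THE BIG-BLOCK `L²` DECAY OF `G₁,k(V) − G₁,k(U)`, EVERY HEIGHT, WITH NO CONJUGATED
# TWO-BACKGROUND LETTER DISPLAYED** — I-7 `B9Eq326DeltaABlockDecayTowerTwoBackgroundsClosed.norm_block_G1k_sub_G1k_le_closed` with its LAST displayed
# conjugated two-background letter, the `R_k`-slot `hTR` (`δ_R`), DISCHARGED by I-11
# `B9Eq349ConjugatedProjectionDifferenceTowerTwoBackgrounds.norm_expConj_RofUk_sub_expConj_RofUk_le`: `δ_R := ρ₂(r)` becomes a DEFINITIONAL binder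
# (`= O(δ + max_j δ_j)` in the bond closeness `δ` and the level averages' closeness `δ_j`, through `b_D = 2e^{rℓη}M_φM_φ′√d·δ`,
# `b_Q = e^{rℓ′}P_ε(T_{ε,δ} − 1)√(c₁∕(c₀L^{(n+1)d}))`), at the price of ONE new Gram window `β′·s_A·(4∕γ′)(2M+1) ≤ κ₁∕2`.  After this file the N52
# road (α) END — `‖P_{y₁}(G₁,k(V) − G₁,k(U))P_{y₀}‖ ≤ C·e^{r}e^{−r·d_m(y₀,y₁)}` — displays ONLY: `γ` + `hpos` at `U` and at `V` (Thm 3.11 for `Δ_{a,k}`), the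
# `G′_k` side (`γ′, a′, hpos′, κ₁, M`) at `U` and at `V`, the MODEL letters (bond ∕ plaquette smallness and closeness, level averages `U1`-valued, regular,
# `ε_j`-small, `δ_j`-close with geometric profiles) and the CLOSED windows (closed, not solved for `r`)

statement-level skeleton of published theorems with citation tags; proofs where landed; nothing here is a claim about the Yang–Mills mass gap

PDF held: `paper:balaban1985-cmp99-background-propagators` (journal page = PDF page + 388); pp. 393–395, 399, 404, 416 read through the suppliers' headers.

CITATION HEADER (lean-in-tree rule 2026-08-18).  Audit cell `pub-balaban`, sub-cell `t4`, NE9 crux team (2): LEAF PROVER 01 (`b2b-balaban-t4-ne9-formalise-leaf-01`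
gen 90), I-12 = the N52 road (α) END with `δ_R` discharged (ne9-leaf-04 g81's located plan (M+) for `δ_R` executed in I-8 … I-11 of this generation).
TEMPLATE CREDITED: I-7 (its statement verbatim but for the two `δ_R` binders; its discharge pattern).

WHAT IS PROVED (sorry-free; 0 `def`; [folklore] composition BY NAME; nothing of [B9] asserted as printed).
* **`norm_block_G1k_sub_G1k_le_closed_deltaR`** — I-7's theorem with `(hδR : 0 ≤ δ_R)` and the `hTR` bundle GONE, in exchange for `hwinc` and the
  definitional binders `hbD`, `hbQ`, `hσR`, `hδR` (the conclusion is I-7's BYTE FOR BYTE, `δ_R` now pinned to `ρ₂(r)`).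
MODEL ∕ DECLARED READINGS.  Those of I-7.
HONEST SCOPE.  [folklore]; every conjugated letter of the route's Combes–Thomas substitute is now discharged down to (CDT)∕Thm 3.11-currency letters and the
MODEL; the windows are CLOSED but not solved for `r`; KAPPA1 load-bearing; no number evaluated; NOT print's kernel (3.86) currency; NOT NE9; «NE9 ⇐ the
named binders»; NE9 NOT PRINTED ∕ NOT PROVED; NOT summit progress (cell pub-balaban: row NE9 WALLED ON A MODEL (O-NE9-1; #5 UNRULED); spine PROVED 0∕9;
rung (B)+1 finite T⁴ — NOT infinite volume, NOT mass gap, NOT BetaPertH, NOT Clay; HONEST DEPENDENCY: continuum YM on T⁴ ⇐ BetaPertH ∧ nine spine estimates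
(0/9 proved); BetaPertH ⇐ (D1) ∧ (D4) ∧ CAP+tail; G-an2-4 gates asym, D1 and NE2/3/4).  NEW file; nothing modified.  Net new unproved facts: 0.
-/

noncomputable section

open scoped InnerProductSpace ComplexConjugate BigOperators
open NormedSpace

namespace Literature.MathematicalPhysics.QuantumFieldTheory.Balaban1983to89.B9Eq326DeltaABlockDecayTowerTwoBackgroundsDeltaR

open B4Sect5Torus (TSite tdist)
open B9SectCLatticeCarrier (Bond bpos btgt)
open B9Eq311L2Pairing (WL2)
open B9Eq319QprimeTorus (blockCoord)
open B9Eq315QTower (towerP)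
open B9Eq315QTorus (perCfg cornerSite)
open B7Prop1Explicit (Wcx boxVec)
open B9Eq316TowerFlatIsOneStep (siteCast siteCast_rfl towerP_eq_fineP_pow)
open B7Prop1Explicit (U1)
open B11Eq103H1Complex (SiteL2K BondL2K covDivL2K)
open B9Eq310HessianOperator (adTransportW PlaqL2K curvOp)
open B9Eq310DeltaPrime (plaqHolU)
open B9Eq326OperatorTower (laplaceAk RofUk G1k QkW)
open B9SectCLatticeCarrier (DirPair)
open B9Eq310DeltaPrime (reHol imHol)
open B11Eq103H1Complex (covDerivL2K)
open B9Eq326OperatorTower (QprimeTowerW)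
open B9Eq324DeltaPrimeATower (laplacePrimeAk GpOfUk)
open B9Eq326DeltaABlockDecayTowerTwoBackgroundsClosed (norm_block_G1k_sub_G1k_le_closed)
open B9Eq349ConjugatedProjectionDifferenceTowerTwoBackgrounds (norm_expConj_RofUk_sub_expConj_RofUk_le)

variable {d : ℕ} {L : ℕ} [NeZero L] {m : Fin d → ℕ} [∀ i, NeZero (m i)] {n : ℕ}
  {𝔸 : Type*} [NormedRing 𝔸] [StarRing 𝔸] [NormedAlgebra ℂ 𝔸] [StarModule ℂ 𝔸] [CompleteSpace 𝔸] [NormOneClass 𝔸]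
  {W : Type*} [NormedAddCommGroup W] [InnerProductSpace ℂ W] [FiniteDimensional ℂ W] (φ : W ≃ₗ[ℂ] 𝔸) {Mφ Mφ' : ℝ}
  (hφ : ∀ w, ‖φ w‖ ≤ Mφ * ‖w‖) (hφ' : ∀ X, ‖φ.symm X‖ ≤ Mφ' * ‖X‖) (hMφ : 0 ≤ Mφ) (hMφ' : 0 ≤ Mφ')
  {c₀ : ℝ} [Fact (0 < c₀)] {c₁ : ℝ} [Fact (0 < c₁)] {η : ℝ} (hη : 0 < η) (hηL : η * (L : ℝ) ^ (n + 1) = 1)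
  (U V : Bond d (towerP L m (n + 1)) → 𝔸ˣ) (hU : ∀ b, U b ∈ U1 𝔸) (hV : ∀ b, V b ∈ U1 𝔸)
  (hRSU : ∀ (b : Bond d (towerP L m (n + 1))) (v u : W), ⟪adTransportW φ U b v, u⟫_ℂ = ⟪v, adTransportW φ (fun b => (U b)⁻¹) b u⟫_ℂ)
  (hRSV : ∀ (b : Bond d (towerP L m (n + 1))) (v u : W), ⟪adTransportW φ V b v, u⟫_ℂ = ⟪v, adTransportW φ (fun b => (V b)⁻¹) b u⟫_ℂ)
  (τ : 𝔸 →ₗ[ℂ] ℂ) (hL : 1 ≤ L) (α : ℕ → ℝ) (hα1 : ∀ j, α j ≤ 1 / 64)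
  (hU1U : ∀ (j : ℕ) (x : B7Prop1Explicit.Site d) (κ : Fin d), perCfg (towerP L m (j + 1)) (B9Eq315QTower.UlevOf L m (n + 1) U j) x κ ∈ U1 𝔸)
  (hregU : ∀ (j : ℕ) (y : TSite d (towerP L m j)) (κ : Fin d) (r : Fin d → Fin L),
    ‖((Wcx L (perCfg (towerP L m (j + 1)) (B9Eq315QTower.UlevOf L m (n + 1) U j)) (cornerSite L y) κ (boxVec L r) : 𝔸ˣ) : 𝔸) - 1‖ ≤ α j)
  (hU1V : ∀ (j : ℕ) (x : B7Prop1Explicit.Site d) (κ : Fin d), perCfg (towerP L m (j + 1)) (B9Eq315QTower.UlevOf L m (n + 1) V j) x κ ∈ U1 𝔸)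
  (hregV : ∀ (j : ℕ) (y : TSite d (towerP L m j)) (κ : Fin d) (r : Fin d → Fin L),
    ‖((Wcx L (perCfg (towerP L m (j + 1)) (B9Eq315QTower.UlevOf L m (n + 1) V j)) (cornerSite L y) κ (boxVec L r) : 𝔸ˣ) : 𝔸) - 1‖ ≤ α j)
  (a : ℝ)

include hφ hφ' hMφ hMφ' hη hηL hU hV hRSU hRSV in
/-- **THE BIG-BLOCK `L²` DECAY OF `G₁,k(V) − G₁,k(U)` WITH NO CONJUGATED TWO-BACKGROUND LETTER DISPLAYED**: I-7's `norm_block_G1k_sub_G1k_le_closed` with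
`hTR := B9Eq349ConjugatedProjectionDifferenceTowerTwoBackgrounds.norm_expConj_RofUk_sub_expConj_RofUk_le` and `δ_R := ρ₂(r)` (definitional binders `hbD`,
`hbQ`, `hσR`, `hδR`; one new Gram window `hwinc`). [folklore]
[cite: Balaban1985BackgroundPropagators, (3.26) p.395, (3.15)–(3.19) p.393, (3.21) p.394, (3.25) p.394, (3.49) p.399, (3.69) p.404, Thm 3.11 p.416; Balaban1985Variational, (110) p.294] -/
theorem norm_block_G1k_sub_G1k_le_closed_deltaR (ha : 0 ≤ a) (hm : ∀ i, 1 ≤ m i)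
    (hposU : ∀ x : BondL2K ℂ d (towerP L m (n + 1)) c₀ W, x ≠ 0 → 0 < RCLike.re ⟪x, laplaceAk L m n φ η U hL α hα1 hU1U hregU τ (c₀ := c₀) (c₁ := c₁) a x⟫_ℂ)
    (hposV : ∀ x : BondL2K ℂ d (towerP L m (n + 1)) c₀ W, x ≠ 0 → 0 < RCLike.re ⟪x, laplaceAk L m n φ η V hL α hα1 hU1V hregV τ (c₀ := c₀) (c₁ := c₁) a x⟫_ℂ)
    {γ β βK ℓ ℓ' r ρ : ℝ} (hγ : 0 < γ) (hβ : 0 ≤ β) (hℓ : 1 ≤ ℓ) (hℓ' : 1 ≤ ℓ') (hr : 0 ≤ r) (hρ : 0 ≤ ρ) (hρ8 : ρ ≤ 1 / 8)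
    (hcoerU : ∀ f : BondL2K ℂ d (towerP L m (n + 1)) c₀ W, γ * ‖f‖ ^ 2 ≤ RCLike.re ⟪f, laplaceAk L m n φ η U hL α hα1 hU1U hregU τ (c₀ := c₀) (c₁ := c₁) a f⟫_ℂ)
    (hcoerV : ∀ f : BondL2K ℂ d (towerP L m (n + 1)) c₀ W, γ * ‖f‖ ^ 2 ≤ RCLike.re ⟪f, laplaceAk L m n φ η V hL α hα1 hU1V hregV τ (c₀ := c₀) (c₁ := c₁) a f⟫_ℂ)
    (hwin : r * ℓ * η ≤ 1)
    (hβCC : 4 * r * ℓ * (Mφ * Mφ') * (d * Real.sqrt d) ≤ β) (hβC : 4 * r * ℓ * (Mφ * Mφ') * d ≤ β)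
    (hβD : 2 * r * ℓ * (Mφ * Mφ') * Real.sqrt d ≤ β)
    -- the bond closeness of the two backgrounds, and the TREE's binders for the two Lipschitz letters `e_R`, `e_Q` (now DISCHARGED):
    {δ : ℝ} (hδ : 0 ≤ δ) (hUV : ∀ b, ‖(U b : 𝔸) - (V b : 𝔸)‖ ≤ δ * η)
    -- ne9-leaf-04 g81's binders for the conjugated `Δ′` letter (`B9Eq369CurvFormConjugationTwoBackgrounds` §4, two closeness letters): the involution
    -- and trace bounds, the plaquette window `ε` of `U`, the plaquette closeness `δ_p`
    (hstar : ∀ X : 𝔸, ‖star X‖ ≤ ‖X‖) {Cτ : ℝ} (hτ : ∀ X, ‖τ X‖ ≤ Cτ * ‖X‖) (hCτ : 0 ≤ Cτ)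
    -- g92's curvature-form floor at both backgrounds: the product bound of the trace and the plaquette letters `reHol`, `imHol`
    {Mτ : ℝ} (hτ2 : ∀ X Y : 𝔸, ‖τ (X * Y)‖ ≤ Mτ * ‖X‖ * ‖Y‖) (hMτ : 0 ≤ Mτ) {δpl : ℝ} (hδpl : 0 ≤ δpl)
    (hReU : ∀ p : B9SectCLatticeCarrier.Plaq d (towerP L m (n + 1)), ‖reHol U p - 1‖ ≤ δpl)
    (hImU : ∀ p : B9SectCLatticeCarrier.Plaq d (towerP L m (n + 1)), ‖imHol U p‖ ≤ δpl)
    (hReV : ∀ p : B9SectCLatticeCarrier.Plaq d (towerP L m (n + 1)), ‖reHol V p - 1‖ ≤ δpl)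
    (hImV : ∀ p : B9SectCLatticeCarrier.Plaq d (towerP L m (n + 1)), ‖imHol V p‖ ≤ δpl)
    {ε : ℝ} (hε : 0 ≤ ε) (hpl : ∀ p : B9SectCLatticeCarrier.Plaq d (towerP L m (n + 1)), ‖(plaqHolU U p : 𝔸) - 1‖ ≤ ε)
    {δp : ℝ} (hδp : 0 ≤ δp) (hpp : ∀ p : B9SectCLatticeCarrier.Plaq d (towerP L m (n + 1)), ‖(plaqHolU U p : 𝔸) - (plaqHolU V p : 𝔸)‖ ≤ δp)
    -- (3.16)'s weight relation, the bond smallness of both backgrounds, the common level profiles (`B9Eq325RLipschitzSqrtTowerTwoBackgroundsLinear`'s binders)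
    (hw : c₀ * ((L : ℝ) ^ (n + 1)) ^ d = c₁) {a' : ℝ} (ha' : 0 < a') {αb : ℝ} (hαb : 0 ≤ αb)
    -- the `G′_k` side of the `dR` chain and of the tower `C_P` letter, at both backgrounds (ne9-leaf-03's (PDCT), the OWNER's (HQKT) binders verbatim)
    (hpos'U : ∀ x : SiteL2K ℂ d (towerP L m (n + 1)) c₀ W, x ≠ 0 → 0 < RCLike.re ⟪x, laplacePrimeAk L m n φ η U a' (c₁ := c₁) x⟫_ℂ)
    (hpos'V : ∀ x : SiteL2K ℂ d (towerP L m (n + 1)) c₀ W, x ≠ 0 → 0 < RCLike.re ⟪x, laplacePrimeAk L m n φ η V a' (c₁ := c₁) x⟫_ℂ)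
    {γ' κ₁ M : ℝ} (hγ' : 0 < γ') (hγ'1 : γ' ≤ 1) (hκ₁ : 0 < κ₁) (hM : 0 ≤ M)
    (coerciveU : ∀ f : SiteL2K ℂ d (towerP L m (n + 1)) c₀ W, γ' * ‖f‖ ^ 2 ≤ ‖(covDerivL2K ℂ c₀ ((η : ℂ))⁻¹ (adTransportW φ U)) f‖ ^ 2 +
      a' * ‖((WL2.linearEquiv ℂ ℂ (fun _ : TSite d m => c₁)).symm.toLinearMap ∘ₗ QprimeTowerW L m n φ U (c₀ := c₀)) f‖ ^ 2)
    (coerciveV : ∀ f : SiteL2K ℂ d (towerP L m (n + 1)) c₀ W, γ' * ‖f‖ ^ 2 ≤ ‖(covDerivL2K ℂ c₀ ((η : ℂ))⁻¹ (adTransportW φ V)) f‖ ^ 2 +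
      a' * ‖((WL2.linearEquiv ℂ ℂ (fun _ : TSite d m => c₁)).symm.toLinearMap ∘ₗ QprimeTowerW L m n φ V (c₀ := c₀)) f‖ ^ 2)
    (hκU : ∀ ψ : SiteL2K ℂ d m c₁ W, κ₁ * ‖ψ‖ ^ 2 ≤ RCLike.re ⟪ψ,
      (((WL2.linearEquiv ℂ ℂ (fun _ : TSite d m => c₁)).symm.toLinearMap ∘ₗ QprimeTowerW L m n φ U (c₀ := c₀)) ∘ₗ
        GpOfUk L m n φ η U a' (c₁ := c₁) hpos'U ∘ₗ GpOfUk L m n φ η U a' (c₁ := c₁) hpos'U ∘ₗ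
        LinearMap.adjoint ((WL2.linearEquiv ℂ ℂ (fun _ : TSite d m => c₁)).symm.toLinearMap ∘ₗ QprimeTowerW L m n φ U (c₀ := c₀))) ψ⟫_ℂ)
    (hκV : ∀ ψ : SiteL2K ℂ d m c₁ W, κ₁ * ‖ψ‖ ^ 2 ≤ RCLike.re ⟪ψ,
      (((WL2.linearEquiv ℂ ℂ (fun _ : TSite d m => c₁)).symm.toLinearMap ∘ₗ QprimeTowerW L m n φ V (c₀ := c₀)) ∘ₗ
        GpOfUk L m n φ η V a' (c₁ := c₁) hpos'V ∘ₗ GpOfUk L m n φ η V a' (c₁ := c₁) hpos'V ∘ₗ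
        LinearMap.adjoint ((WL2.linearEquiv ℂ ℂ (fun _ : TSite d m => c₁)).symm.toLinearMap ∘ₗ QprimeTowerW L m n φ V (c₀ := c₀))) ψ⟫_ℂ)
    (hMQU : ∀ s : SiteL2K ℂ d (towerP L m (n + 1)) c₀ W,
      ‖((WL2.linearEquiv ℂ ℂ (fun _ : TSite d m => c₁)).symm.toLinearMap ∘ₗ QprimeTowerW L m n φ U (c₀ := c₀)) s‖ ≤ M * ‖s‖)
    (hMQV : ∀ s : SiteL2K ℂ d (towerP L m (n + 1)) c₀ W,
      ‖((WL2.linearEquiv ℂ ℂ (fun _ : TSite d m => c₁)).symm.toLinearMap ∘ₗ QprimeTowerW L m n φ V (c₀ := c₀)) s‖ ≤ M * ‖s‖)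
    -- the route's smallness with `p_K` and `C_P` at their suppliers' values (g92's curvature-form floor; the tower `C_P = √(M∕√κ₁)`)
    (small : 3 / 4 * (768 * Fintype.card (DirPair d) * Mτ * Mφ ^ 2 * (‖((η : ℂ)) ^ d‖ / c₀) * ‖((η : ℂ))⁻¹‖ ^ 2 * δpl) + (21 + 3 * a) * β ^ 2 +
      4 * β * Real.sqrt (M / Real.sqrt κ₁) + 2 * ρ * Real.sqrt (M / Real.sqrt κ₁) ^ 2 + βK ≤ γ / 8)
    (hUε : ∀ b, ‖(U b : 𝔸) - 1‖ ≤ αb * η) (hVε : ∀ b, ‖(V b : 𝔸) - 1‖ ≤ αb * η)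
    (εU δUV : ℕ → ℝ) (hεU : ∀ j, 0 ≤ εU j) (hδUV : ∀ j, 0 ≤ δUV j)
    (hLεU : ∀ (j : ℕ) (b : Bond d (towerP L m (j + 1))), ‖(B9Eq315QTower.UlevOf L m (n + 1) U j b : 𝔸) - 1‖ ≤ εU j)
    (hLεV : ∀ (j : ℕ) (b : Bond d (towerP L m (j + 1))), ‖(B9Eq315QTower.UlevOf L m (n + 1) V j b : 𝔸) - 1‖ ≤ εU j)
    (hLbU : ∀ (j : ℕ) (b : Bond d (towerP L m (j + 1))), B9Eq315QTower.UlevOf L m (n + 1) U j b ∈ U1 𝔸)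
    (hLbV : ∀ (j : ℕ) (b : Bond d (towerP L m (j + 1))), B9Eq315QTower.UlevOf L m (n + 1) V j b ∈ U1 𝔸)
    (hLUV : ∀ (j : ℕ) (b : Bond d (towerP L m (j + 1))), ‖(B9Eq315QTower.UlevOf L m (n + 1) U j b : 𝔸) - (B9Eq315QTower.UlevOf L m (n + 1) V j b : 𝔸)‖ ≤ δUV j)
    {rp α₀ δ₀ : ℝ} (hrp0 : 0 ≤ rp) (hrp1 : rp < 1) (hαα₀ : αb ≤ α₀) (hδ₀ : 0 < δ₀)
    (hεg : ∀ j < n + 1, εU j ≤ αb * rp ^ j) (hδg : ∀ j < n + 1, δUV j ≤ δ * rp ^ j)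
    {sD sQ θb δbD γR θbG δbA sS sV s₂ sG₂ sA₂ : ℝ}
    (hsD : sD = Real.sqrt d * (2 * Mφ * Mφ'))
    (hsQ : sQ = 2 * (((d * (L - 1) : ℕ) : ℝ) * (2 * Mφ * Mφ') / (1 - rp)))
    (hθb : θb = sQ * α₀) (hδbD : δbD = sD * α₀)
    (hγRdef : γR = 1 / (2 + 2 / a') - (δbD + δbD ^ 2 + a' * θb * (2 * 1 + θb)))
    (hθbG : θbG = 2 * δbD * (γR⁻¹ * (Real.sqrt γR)⁻¹) + (|a'| * θb * ((1 + θb) + 1)) * γR⁻¹ ^ 2)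
    (hδbA : δbA = θbG * (1 + θb) + (2 + 2 / a') * θb)
    (hsS : sS = Real.sqrt (1 / (12 * (d : ℝ) * (6 / 5) ^ (d - 1) + a') ^ 2)) (hsV : sV = sS - δbA)
    (hs₂ : s₂ = 2 * Real.exp ((d * (L - 1) : ℕ) * (2 * Mφ * Mφ' * α₀ / (1 - rp))) *
      ((d * (L - 1) : ℕ) * (2 * Mφ * Mφ') * (1 + 2 * Mφ * Mφ' * α₀) ^ (d * (L - 1)) / (1 - rp)))
    (hsG₂ : sG₂ = 2 * sD * (γR⁻¹ * (Real.sqrt γR)⁻¹) + (|a'| * s₂ * ((1 + θb) + (1 + θb))) * γR⁻¹ ^ 2)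
    (hsA₂ : sA₂ = sG₂ * (1 + θb) + γR⁻¹ * s₂)
    (hc1 : ((d * (L - 1) : ℕ) : ℝ) * (2 * Mφ * Mφ') / (1 - rp) * α₀ ≤ 1) (hγR : 0 < γR) (hDγ : δbD ≤ 1 / (2 + 2 / a')) (hsV0 : 0 < sV)
    (hB : ((d * (L - 1) : ℕ) * (2 * Mφ * Mφ') * (1 + 2 * Mφ * Mφ' * α₀) ^ (d * (L - 1)) / (1 - rp)) * δ₀ ≤ 1) (hwinR : 2 * sA₂ * δ₀ ≤ sV)
    -- `B9Eq315QTowerLipschitzL2TwoBackgroundsChain`'s extra binders (the `Q_k` letter)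
    (hα128 : ∀ j, α j ≤ 1 / 128) (hδmax : ∀ j, δUV j ≤ 1 / (12288 * ((2 * (d * L) + L + L : ℕ) : ℝ)))
    (hwinQ : Real.sqrt ((L : ℝ) ^ d) * (Real.sqrt (2 * d) * (75497472 * ((d : ℝ) + 1) * ((2 * (d * L) + L + L : ℕ) : ℝ))) / (1 - rp) * δ ≤ 1)
    -- the two windows of the conjugated two-background `Q_k` letters (the companion's, at `ι := ℓη`) and their constant `δ_Q(r)` as a definitional binder
    (hwinQ0 : r * (3 * ℓ' + (L : ℝ) ^ (n + 1) * (ℓ * η)) ≤ 1) (hwinQ1 : r * (2 * d * (L : ℝ) ^ n * (ℓ * η)) ≤ 1)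
    -- the CLOSED windows of the four conjugation letters (the OWNER's (HQKT) `hQK_of_chain_tower`, at the radius `r` and the common level profile `ε_j`)
    (hwin' : r * ℓ' ≤ 1) {β' : ℝ} (hβ'0 : 0 ≤ β') (hβ'1 : β' ≤ 1)
    (hβT : Mφ' * Mφ * Real.sqrt (c₁ / (c₀ * ((L : ℝ) ^ (n + 1)) ^ d)) *
      ((∏ j ∈ Finset.range (n + 1), (1 + Real.sqrt ((L : ℝ) ^ d) * (Real.sqrt (2 * d) * (102 * (d + 1) ^ 2 * L * εU j) +
          2 * (r * (if j = 0 then 3 * ℓ' + (L : ℝ) ^ (n + 1) * (ℓ * η) else 2 * d * (L : ℝ) ^ (n + 1 - j) * (ℓ * η))) *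
            Real.sqrt (2 * (2 * d * (102 * (d + 1) ^ 2 * L * εU j) ^ 2 + ((L : ℝ) ^ d)⁻¹))))) -
        ∏ j ∈ Finset.range (n + 1), (1 + Real.sqrt ((L : ℝ) ^ d) * (Real.sqrt (2 * d) * (102 * (d + 1) ^ 2 * L * εU j)))) ≤ β)
    (hβKw : 8 * (r * (ℓ * η)) * (768 * Fintype.card (DirPair d) * Mτ * Mφ ^ 2 * (‖((η : ℂ)) ^ d‖ / c₀) * ‖((η : ℂ))⁻¹‖ ^ 2 * δpl) ≤ βK)
    (hβ'D : 2 * r * ℓ * (Mφ * Mφ') * Real.sqrt d ≤ β') (hβ'Q : 2 * r * ℓ' * M ≤ β')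
    (smallG : 3 * (1 + a') * β' ^ 2 ≤ γ' / 4) (hwinκ : 12 * (β' * (4 / γ' + M * ((4 / γ') ^ 2 * (3 + a' * (2 * M + 1))))) ≤ Real.sqrt κ₁)
    (hρw : (6 * (β' * (4 / γ' + M * ((4 / γ') ^ 2 * (3 + a' * (2 * M + 1))))) + 9 * (β' * (4 / γ' + M * ((4 / γ') ^ 2 * (3 + a' * (2 * M + 1)))))) /
      Real.sqrt κ₁ ≤ ρ)
    -- the conjugated two-background `R_k`-letter `δ_R` DISCHARGED (I-11): ONE new Gram window and the definitional binders `b_D`, `b_Q`, `σ_R`, `δ_R`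
    (hwinc : β' * ((4 / γ' + M * ((4 / γ') ^ 2 * (3 + a' * (2 * M + 1)))) * (4 / γ') * (2 * M + 1)) ≤ κ₁ / 2)
    {bD bQ σR δR : ℝ} (hbD : bD = 2 * Real.exp (r * (ℓ * η)) * (Mφ * Mφ') * Real.sqrt d * δ)
    (hbQ : bQ = Real.exp (r * ℓ') * ((∏ j ∈ Finset.range (n + 1), (1 + 2 * Mφ * Mφ' * εU j) ^ (d * (L - 1))) *
        ((∏ j ∈ Finset.range (n + 1), (1 + (d * (L - 1) : ℕ) * (2 * Mφ * Mφ' * δUV j) * (1 + 2 * Mφ * Mφ' * εU j) ^ (d * (L - 1)))) - 1) *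
        Real.sqrt (c₁ / (c₀ * ((L : ℝ) ^ (n + 1)) ^ d))))
    (hσR : σR = 4 / γ' * bQ + bQ * (4 / γ') + 2 * (M + 1) * ((4 / γ') ^ 2 * (2 * bD + (1 + β') * bD + a' * (M + 1) * (bQ + bQ))))
    (hδR : δR = σR * (2 / κ₁) * (4 / γ' * (M + 1)) +
        4 / γ' * (M + 1) * ((2 / κ₁) * (σR * (4 / γ' * (M + 1)) + 4 / γ' * (M + 1) * σR) * (2 / κ₁)) * (4 / γ' * (M + 1)) +
      4 / γ' * (M + 1) * (2 / κ₁) * σR)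
    {δQ : ℝ} (hδQ : δQ = Mφ' * Mφ * Real.sqrt (c₁ / (c₀ * ((L : ℝ) ^ (n + 1)) ^ d)) *
        ((∏ j ∈ Finset.range (n + 1), (1 + Real.sqrt ((L : ℝ) ^ d) * (Real.sqrt (2 * d) * (102 * (d + 1) ^ 2 * L * εU j) +
            2 * (r * (if j = 0 then 3 * ℓ' + (L : ℝ) ^ (n + 1) * (ℓ * η) else 2 * d * (L : ℝ) ^ (n + 1 - j) * (ℓ * η))) *
              Real.sqrt (2 * (2 * d * (102 * (d + 1) ^ 2 * L * εU j) ^ 2 + ((L : ℝ) ^ d)⁻¹))))) *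
          ((∏ j ∈ Finset.range (n + 1), (1 + Real.sqrt ((L : ℝ) ^ d) *
              ((1 + 2 * (r * (if j = 0 then 3 * ℓ' + (L : ℝ) ^ (n + 1) * (ℓ * η) else 2 * d * (L : ℝ) ^ (n + 1 - j) * (ℓ * η)))) * (2 * d) *
                (75497472 * ((d : ℝ) + 1) * ((2 * (d * L) + L + L : ℕ) : ℝ) * δUV j)))) - 1)))
    (PB : TSite d m → BondL2K ℂ d (towerP L m (n + 1)) c₀ W →L[ℂ] BondL2K ℂ d (towerP L m (n + 1)) c₀ W)
    (hPB : ∀ (y : TSite d m) (f : BondL2K ℂ d (towerP L m (n + 1)) c₀ W) (b : Bond d (towerP L m (n + 1))),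
      WL2.equiv ℂ (fun _ : Bond d (towerP L m (n + 1)) => c₀) W (PB y f) b =
        if blockCoord (L ^ (n + 1)) m (siteCast (towerP_eq_fineP_pow L m (n + 1)) (bpos b)) = y then
          WL2.equiv ℂ (fun _ : Bond d (towerP L m (n + 1)) => c₀) W f b else 0)
    (y₀ y₁ : TSite d m) :
    ‖PB y₁ ∘L (LinearMap.toContinuousLinearMap (G1k L m n φ η V hL α hα1 hU1V hregV τ (c₀ := c₀) (c₁ := c₁) hposV) - LinearMap.toContinuousLinearMap (G1k L m n φ η U hL α hα1 hU1U hregU τ (c₀ := c₀) (c₁ := c₁) hposU)) ∘L PB y₀‖ ≤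
      (((1 + β) * (4 * Real.exp (r * (ℓ * η)) * (Mφ * Mφ') * (d * Real.sqrt d) * δ) + (4 * Real.exp (r * (ℓ * η)) * (Mφ * Mφ') * (d * Real.sqrt d) * δ) * (1 + β) + (4 * Real.exp (r * (ℓ * η)) * (Mφ * Mφ') * (d * Real.sqrt d) * δ) * (4 * Real.exp (r * (ℓ * η)) * (Mφ * Mφ') * (d * Real.sqrt d) * δ)) +
          ((1 + Real.sqrt (M / Real.sqrt κ₁) + β) * ((1 + ρ) * (2 * Real.exp (r * (ℓ * η)) * (Mφ * Mφ') * Real.sqrt d * δ) + δR * (1 + Real.sqrt (M / Real.sqrt κ₁) + β)) + (2 * Real.exp (r * (ℓ * η)) * (Mφ * Mφ') * Real.sqrt d * δ) * ((1 + ρ) * (1 + Real.sqrt (M / Real.sqrt κ₁) + β)) +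
            (2 * Real.exp (r * (ℓ * η)) * (Mφ * Mφ') * Real.sqrt d * δ) * ((1 + ρ) * (2 * Real.exp (r * (ℓ * η)) * (Mφ * Mφ') * Real.sqrt d * δ) + δR * (1 + Real.sqrt (M / Real.sqrt κ₁) + β))) +
          (Real.exp (2 * (r * (ℓ * η))) * (16 * d * Cτ * Mφ ^ 2 * (|η| ^ d / c₀) * (‖((η : ℂ))⁻¹‖ ^ 2 * (12 * (δ * η) * ε + 3 * δp)))) + ((Real.sqrt a + |a| * β) * δQ + δQ * (Real.sqrt a + |a| * β) + |a| * (δQ * δQ))) / min (1 / 4) (γ / 8) *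
        ((1 + (8 * Real.sqrt d * (Mφ * Mφ') * δ + 2 * Mφ * Mφ' * δ * Real.sqrt d + (max (3 * sA₂ / sV) (2 / δ₀) * δ) * (1 + Real.sqrt (M / Real.sqrt κ₁)) + Real.sqrt a *
          (Mφ' * Mφ * Real.sqrt (c₁ / (c₀ * ((L : ℝ) ^ (n + 1)) ^ d)) * (2 * Real.exp (Real.sqrt ((L : ℝ) ^ d) * (Real.sqrt (2 * d) * (102 * (d + 1) ^ 2 * L)) * (αb / (1 - rp))) * (Real.sqrt ((L : ℝ) ^ d) * (Real.sqrt (2 * d) * (75497472 * ((d : ℝ) + 1) * ((2 * (d * L) + L + L : ℕ) : ℝ))) / (1 - rp) * δ))))) * (min (1 / 4) (γ / 8))⁻¹) * Real.exp r * Real.exp (-(r * tdist m y₀ y₁)) := by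
  have hbD0 : 0 ≤ bD := by rw [hbD]; positivity
  have hbQ0 : 0 ≤ bQ := by
    rw [hbQ]
    exact mul_nonneg (Real.exp_pos _).le (B9Eq349ConjugatedQprimeTowerTwoBackgrounds.deltaQprime_of_levels (L := L) (m := m) (n := n) φ
      hMφ hMφ' hφ hφ' (c₀ := c₀) (c₁ := c₁) U V εU δUV hεU hδUV hLεU hLεV hLbU hLbV hLUV).1
  have hγ4 : 0 ≤ 4 / γ' := by positivity
  have hσ0 : 0 ≤ σR := by rw [hσR]; positivity
  have hδR0 : 0 ≤ δR := by rw [hδR]; positivity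
  have hTR := norm_expConj_RofUk_sub_expConj_RofUk_le (L := L) (m := m) (n := n) hφ hφ' hMφ hMφ' hη hU hV ha'.le hRSU hRSV hpos'U hpos'V
    (zero_le_one.trans hℓ) (zero_le_one.trans hℓ') hδ hUV εU δUV hεU hδUV hLεU hLεV hLbU hLbV hLUV hγ' hγ'1 hκ₁ hM hβ'0 hβ'1 coerciveU coerciveV
    hκU hκV hMQU hMQV hwin hwin' hβ'D hβ'Q smallG hwinc hbD hbQ hσR
  rw [← hδR] at hTR
  exact norm_block_G1k_sub_G1k_le_closed φ hφ hφ' hMφ hMφ' hη hηL U V hU hV hRSU hRSV τ hL α hα1 hU1U hregU hU1V hregV a ha hm hposU hposV hγ hβ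
    hℓ hℓ' hr hρ hρ8 hcoerU hcoerV hwin hβCC hβC hβD hδR0 hTR hδ hUV hstar hτ hCτ hτ2 hMτ hδpl hReU hImU hReV hImV hε hpl hδp hpp hw ha' hαb
    hpos'U hpos'V hγ' hγ'1 hκ₁ hM coerciveU coerciveV hκU hκV hMQU hMQV small hUε hVε εU δUV hεU hδUV hLεU hLεV hLbU hLbV hLUV hrp0 hrp1 hαα₀
    hδ₀ hεg hδg hsD hsQ hθb hδbD hγRdef hθbG hδbA hsS hsV hs₂ hsG₂ hsA₂ hc1 hγR hDγ hsV0 hB hwinR hα128 hδmax hwinQ hwinQ0 hwinQ1 hwin' hβ'0 hβ'1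
    hβT hβKw hβ'D hβ'Q smallG hwinκ hρw hδQ PB hPB y₀ y₁

end Literature.MathematicalPhysics.QuantumFieldTheory.Balaban1983to89.B9Eq326DeltaABlockDecayTowerTwoBackgroundsDeltaR

end
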